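import Summits.Ventures.Crystal3D.Theorems.StickyWulffConstantPolycrystalWulffBoundInclinedLamellarSections
import Literature.Analysis.Convexity.CavalieriSlices
import Literature.Analysis.Convexity.AnisotropicPerimeterPolytopePrism
import Literature.Analysis.Convexity.OpenHPolytope
import HarnessLib

/-!
# TB-D assembly, part 4: two generic tools — COVERAGE of facets in an a.e.-filled region, and a GOOD CUT LEVEL (weighted Cavalieri)
# (lane T, crux `TextureLiminfV5`, stmt-Ventures-23912; design memo TB-D-0 §4 (T)/(C), §7 (P1)/(P2))

HONEST FRAMING. Venture `Summits/Ventures/Crystal3D` (cell `crystal3d-full`), route `route-Ventures-StickyWulffConstant`, helper `--supports` the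
law-v5 crux `TextureLiminfV5` (stmt-Ventures-23912).  Elementary measure geometry (census-free, standard axioms); nothing about any cover or mesh;
F-C1 not moved.

* **`facetPoint_mem_closure_others`** — if finitely many open `H`-polytope pieces fill an OPEN set `O` up to a null set, then every point of
  `O` on a facet plane `{⟪p.1,x⟫ = p.2}` of a piece `P_i` (`p ∈ H i`, so `P_i` lies on the side `<`) belongs to the closure of some OTHER piece:
  otherwise a small outer half-ball at the point would be a non-null open subset of `O` missed by every piece.  In the piece ledger
  (`energy_le_pieceLedger`) such facet points are COVERED, hence free of surface energy: this is how the tent pieces of a grain, which fill the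
  solid region a.e. (`BarlowFreeCertificate`'s mass clause), pay nothing there (TB-D-0 §7 (P1)).
* **`exists_level_sum_facetArea_le`** — weighted Cavalieri selection: for bounded measurable sets `S_i`, weights `w_i ≥ 0`, a unit normal `n`
  and `a < b` there is a level `t ∈ (a, b)` with
  `Σ_i w_i · facetArea (S_i ∩ {⟪n,x⟫ = t}) n ≤ (Σ_i w_i · |S_i ∩ {a < ⟪n,x⟫ < b}|) / (b − a)`
  (lit `volume_eq_lintegral_volume_chartSlice` + `exists_mem_Ioo_le_of_lintegral_le` + `volume_prism_eq_volume_chartPreimage`): the CUT of a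
  wall cell's prism at a good height costs at most the cell's sliced charge (TB-D-0 §4 (C)).
-/

noncomputable section

namespace Summit.Ventures.Crystal3D.Cruxes.TextureLiminf.TexShadow

open Summit.Ventures.Crystal3D Summit.Ventures.Crystal3D.Theorems MeasureTheory Set
open scoped InnerProductSpace ENNReal
open Literature.Analysis.Convexity (exists_orthonormal_pair_perp volume_prism_eq_volume_chartPreimage
  volume_eq_lintegral_volume_chartSlice measurable_volume_chartSlice exists_mem_Ioo_le_of_lintegral_le)

/-! ### Coverage of facets in an a.e.-filled open region -/

/-- **Facet points inside an a.e.-filled open region are covered by the other pieces.** -/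
theorem facetPoint_mem_closure_others {ι : Type*} [DecidableEq ι] (s : Finset ι) (H : ι → Finset (E3 × ℝ))
    {O : Set E3} (hO : IsOpen O) (hae : volume (O \ ⋃ i ∈ s, polytope (H i)) = 0) {i : ι} {p : E3 × ℝ}
    (hp : p ∈ H i) (hp1 : p.1 ≠ 0) {x : E3} (hx : ⟪p.1, x⟫_ℝ = p.2) (hxO : x ∈ O) :
    x ∈ ⋃ j ∈ s.erase i, closure (polytope (H j)) := by
  by_contra hnot
  have hC : IsClosed (⋃ j ∈ s.erase i, closure (polytope (H j))) :=
    isClosed_biUnion_finset fun _ _ => isClosed_closure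
  obtain ⟨r, hr, hball⟩ := Metric.isOpen_iff.1 (hO.inter hC.isOpen_compl) x ⟨hxO, hnot⟩
  have hn : 0 < ‖p.1‖ := norm_pos_iff.2 hp1
  -- the outer half-ball at `x`
  set B : Set E3 := Metric.ball x r ∩ {y : E3 | p.2 < ⟪p.1, y⟫_ℝ} with hB
  have hBO : B ⊆ O \ ⋃ j ∈ s, polytope (H j) := by
    rintro y ⟨hy, hyp⟩
    refine ⟨(hball hy).1, fun hmem => ?_⟩
    obtain ⟨j, hj, hyj⟩ := mem_iUnion₂.1 hmem
    by_cases hji : j = i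
    · subst hji
      have hlt : ⟪p.1, y⟫_ℝ < p.2 := by
        simp only [polytope, mem_iInter, mem_setOf_eq] at hyj
        exact hyj p hp
      exact absurd hyp (not_lt.2 hlt.le)
    · exact (hball hy).2 (mem_iUnion₂.2 ⟨j, Finset.mem_erase.2 ⟨hji, hj⟩, subset_closure hyj⟩)
  have hBnull : volume B = 0 := measure_mono_null hBO hae
  have hBopen : IsOpen B := Metric.isOpen_ball.inter (isOpen_lt continuous_const (continuous_const.inner continuous_id))
  have hBne : B.Nonempty := by
    refine ⟨x + (r / 2 / ‖p.1‖) • p.1, ?_, ?_⟩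
    · rw [Metric.mem_ball, dist_eq_norm, add_sub_cancel_left, norm_smul, Real.norm_eq_abs,
        abs_of_pos (div_pos (half_pos hr) hn), div_mul_cancel₀ _ hn.ne']
      linarith
    · show p.2 < ⟪p.1, x + (r / 2 / ‖p.1‖) • p.1⟫_ℝ
      rw [inner_add_right, real_inner_smul_right, real_inner_self_eq_norm_sq, hx]
      have : 0 < r / 2 / ‖p.1‖ * ‖p.1‖ ^ 2 := mul_pos (div_pos (half_pos hr) hn) (pow_pos hn 2)
      linarith
  exact absurd hBnull (hBopen.measure_pos volume hBne).ne'

/-! ### A good cut level -/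

/-- In-plane chart points at height `t` over the unit normal `n` lie on the level plane `{⟪n, x⟫ = t}`. -/
theorem inner_chart_height {n U V : E3} (hn : ‖n‖ = 1) (hnU : ⟪n, U⟫_ℝ = 0) (hnV : ⟪n, V⟫_ℝ = 0) (t : ℝ) (y : ℝ × ℝ) :
    ⟪n, t • n + y.1 • U + y.2 • V⟫_ℝ = t := by
  rw [inner_add_right, inner_add_right, real_inner_smul_right, real_inner_smul_right, real_inner_smul_right,
    real_inner_self_eq_norm_sq, hn, hnU, hnV]
  ring

/-- **Weighted Cavalieri selection of a cut level.**  See the module docstring. -/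
theorem exists_level_sum_facetArea_le {n : E3} (hn : ‖n‖ = 1) {ι : Type*} (T : Finset ι) (w : ι → ℝ)
    (hw : ∀ i ∈ T, 0 ≤ w i) (S : ι → Set E3) (hSm : ∀ i ∈ T, MeasurableSet (S i))
    (hSb : ∀ i ∈ T, Bornology.IsBounded (S i)) {a b : ℝ} (hab : a < b) :
    ∃ t ∈ Set.Ioo a b, ∑ i ∈ T, w i * facetArea (S i ∩ {x : E3 | ⟪n, x⟫_ℝ = t}) n ≤
      (∑ i ∈ T, w i * (volume (S i ∩ {x : E3 | a < ⟪n, x⟫_ℝ ∧ ⟪n, x⟫_ℝ < b})).toReal) / (b - a) := by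
  obtain ⟨U, V, hU, hV, hUV, hnU, hnV⟩ := exists_orthonormal_pair_perp n
  have hband : IsOpen {x : E3 | a < ⟪n, x⟫_ℝ ∧ ⟪n, x⟫_ℝ < b} := by
    rw [Set.setOf_and]
    exact (isOpen_lt continuous_const (continuous_const.inner continuous_id)).inter
      (isOpen_lt (continuous_const.inner continuous_id) continuous_const)
  -- the band pieces `S' i = S i ∩ {a < ⟪n,x⟫ < b}` (opaque name with an equation)
  obtain ⟨S', hS'⟩ : ∃ S' : ι → Set E3, ∀ i, S' i = S i ∩ {x : E3 | a < ⟪n, x⟫_ℝ ∧ ⟪n, x⟫_ℝ < b} :=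
    ⟨_, fun _ => rfl⟩
  have hS'm : ∀ i ∈ T, MeasurableSet (S' i) := fun i hi => by
    rw [hS']; exact (hSm i hi).inter hband.measurableSet
  have hS'fin : ∀ i ∈ T, volume (S' i) ≠ ⊤ := fun i hi => by
    rw [hS']; exact ((hSb i hi).subset Set.inter_subset_left).measure_lt_top.ne
  -- the slice-area functions (opaque name with an equation)
  obtain ⟨A, hA⟩ : ∃ A : ι → ℝ → ℝ≥0∞, ∀ i t,
      A i t = volume {y : ℝ × ℝ | (0 : E3) + t • n + y.1 • U + y.2 • V ∈ S' i} := ⟨_, fun _ _ => rfl⟩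
  have hAm : ∀ i ∈ T, Measurable (A i) := fun i hi => by
    rw [show A i = fun t => volume {y : ℝ × ℝ | (0 : E3) + t • n + y.1 • U + y.2 • V ∈ S' i} from funext (hA i)]
    exact measurable_volume_chartSlice (hS'm i hi) n U V 0
  have hAint : ∀ i ∈ T, ∫⁻ t, A i t = volume (S' i) := fun i hi => by
    rw [show A i = fun t => volume {y : ℝ × ℝ | (0 : E3) + t • n + y.1 • U + y.2 • V ∈ S' i} from funext (hA i)]
    exact (volume_eq_lintegral_volume_chartSlice hn hU hV hUV hnU hnV 0 (hS'm i hi)).symm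
  have hPm : Measurable fun t => ∑ i ∈ T, ENNReal.ofReal (w i) * A i t :=
    Finset.measurable_sum _ fun i hi => (hAm i hi).const_mul _
  have hCvol_fin : (∑ i ∈ T, ENNReal.ofReal (w i) * volume (S' i)) ≠ ⊤ :=
    ENNReal.sum_ne_top.2 fun i hi => ENNReal.mul_ne_top ENNReal.ofReal_ne_top (hS'fin i hi)
  have hPint : ∫⁻ t, ∑ i ∈ T, ENNReal.ofReal (w i) * A i t = ∑ i ∈ T, ENNReal.ofReal (w i) * volume (S' i) := by
    rw [lintegral_finsetSum _ (fun i hi => (hAm i hi).const_mul _)]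
    refine Finset.sum_congr rfl fun i hi => ?_
    rw [lintegral_const_mul _ (hAm i hi), hAint i hi]
  have hba : 0 < b - a := by linarith
  have hba' : ENNReal.ofReal (b - a) ≠ 0 := (ENNReal.ofReal_pos.2 hba).ne'
  have hCfin : (∑ i ∈ T, ENNReal.ofReal (w i) * volume (S' i)) / ENNReal.ofReal (b - a) ≠ ⊤ :=
    ENNReal.div_ne_top hCvol_fin hba'
  have hle : ∫⁻ t in Set.Ioo a b, ∑ i ∈ T, ENNReal.ofReal (w i) * A i t ≤
      (∑ i ∈ T, ENNReal.ofReal (w i) * volume (S' i)) / ENNReal.ofReal (b - a) * ENNReal.ofReal (b - a) := by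
    rw [ENNReal.div_mul_cancel hba' ENNReal.ofReal_ne_top, ← hPint]
    exact setLIntegral_le_lintegral _ _
  obtain ⟨t, ht, hPt⟩ := exists_mem_Ioo_le_of_lintegral_le hab hCfin hPm.aemeasurable hle
  refine ⟨t, ht, ?_⟩
  -- at the level `t`: the slice areas are the prism volumes over the level facets
  have hAeq : ∀ i ∈ T, A i t =
      volume {x : E3 | ∃ y ∈ S i ∩ {x : E3 | ⟪n, x⟫_ℝ = t}, ∃ τ ∈ Set.Icc (0 : ℝ) 1, x = y + τ • n} := by
    intro i hi
    have hF : ∀ y ∈ S i ∩ {x : E3 | ⟪n, x⟫_ℝ = t}, ⟪n, y⟫_ℝ = ⟪n, t • n⟫_ℝ := by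
      rintro y ⟨-, hy⟩
      rw [real_inner_smul_right, real_inner_self_eq_norm_sq, hn, one_pow, mul_one]
      exact hy
    rw [volume_prism_eq_volume_chartPreimage hn hU hV hUV hnU hnV hF, hA]
    have hset : {y : ℝ × ℝ | (0 : E3) + t • n + y.1 • U + y.2 • V ∈ S' i} =
        {y : ℝ × ℝ | t • n + y.1 • U + y.2 • V ∈ S i ∩ {x : E3 | ⟪n, x⟫_ℝ = t}} := by
      ext y
      rw [mem_setOf_eq, mem_setOf_eq, zero_add, hS', mem_inter_iff, mem_inter_iff, mem_setOf_eq, mem_setOf_eq,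
        inner_chart_height hn hnU hnV t y]
      exact ⟨fun h => ⟨h.1, rfl⟩, fun h => ⟨h.1, ht⟩⟩
    rw [hset]
  have hAfin : ∀ i ∈ T, A i t ≠ ⊤ := fun i hi => by
    rw [hAeq i hi]
    exact volume_prism_ne_top_of_isBounded (hSb i hi) _ (fun y hy => subset_closure hy.1) n
  have hslice : ∀ i ∈ T, facetArea (S i ∩ {x : E3 | ⟪n, x⟫_ℝ = t}) n = (A i t).toReal := by
    intro i hi
    unfold facetArea
    rw [hAeq i hi]
  have hPreal : (∑ i ∈ T, ENNReal.ofReal (w i) * A i t).toReal =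
      ∑ i ∈ T, w i * facetArea (S i ∩ {x : E3 | ⟪n, x⟫_ℝ = t}) n := by
    rw [ENNReal.toReal_sum (fun i hi => ENNReal.mul_ne_top ENNReal.ofReal_ne_top (hAfin i hi))]
    refine Finset.sum_congr rfl fun i hi => ?_
    rw [ENNReal.toReal_mul, ENNReal.toReal_ofReal (hw i hi), hslice i hi]
  have hCreal : ((∑ i ∈ T, ENNReal.ofReal (w i) * volume (S' i)) / ENNReal.ofReal (b - a)).toReal =
      (∑ i ∈ T, w i * (volume (S i ∩ {x : E3 | a < ⟪n, x⟫_ℝ ∧ ⟪n, x⟫_ℝ < b})).toReal) / (b - a) := by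
    rw [ENNReal.toReal_div, ENNReal.toReal_ofReal hba.le,
      ENNReal.toReal_sum (fun i hi => ENNReal.mul_ne_top ENNReal.ofReal_ne_top (hS'fin i hi))]
    congr 1
    refine Finset.sum_congr rfl fun i hi => ?_
    rw [ENNReal.toReal_mul, ENNReal.toReal_ofReal (hw i hi), hS']
  have hfinal := ENNReal.toReal_mono hCfin hPt
  rw [hPreal, hCreal] at hfinal
  exact hfinal

end Summit.Ventures.Crystal3D.Cruxes.TextureLiminf.TexShadow

end
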